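import Summits.BirchSwinnertonDyer.BirchSwinnertonDyer.Theorems.PrintCFramBottomClassIndexLawFiveLeKrizLiBindersTwistedBlock
import HarnessLib

/-!
# Crux `PrintCFram.BottomClassIndexLawFiveLe` (stmt-BirchSwinnertonDyer-20372), line `eisenstein-resource-bdp-line` (registry v10/v11):
# the twisted-member ENGINE of the Kriz–Li character ∧ `ε_K` ∧ Bernoulli-(4) block with an odd SQUAREFREE (not necessarily prime) `|d_K|`
# (cell `bsd-print-cfram`, width seat `bsd-line-cfram-p1-w5` g0; THEOREMS ONLY, `--supports` 20372; BSD is not proved by any of this)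

HONEST FRAMING. Nothing here proves BSD or closes a stub. w3 g3's `KrizLiBindersTwisted.krizLi_characterBernoulliBlock_twist_odd`
(`…KrizLiBindersTwistedBlock`) assembles the block `(f ψ ω εK ∣ hψ hω hss h1 h1' h3 h4)` of the composition's Kriz–Li branch at a twisted member
`W ∼ W₁ ≅ E^{(e)}` (`e ≡ 1 (mod 4)`) over a Heegner field `K'' = ℚ(√−q)` with `q` PRIME. Six of the census rows of the `≥ 5` window have a
COMPOSITE `|d_K|` at their first passing discriminant (`9025a1`, `61009a1`, `303601f1`, `312481d1`: `−51`; `104329a1`: `−15`; `159201t1`: `−143`).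
THIS FILE is the same engine with `q` an odd SQUAREFREE integer coprime to `p·e` — the proof is w3 g3's, line by line, with the four uses of
primality (`Odd q`, `Squarefree q`, `q ⊥ p`, `q ⊥ e`) turned into hypotheses; `ε_K(a) = J(a | q)` is primitive of conductor `q` for odd
squarefree `q` (w3 g2's `KrizLiBinders.isPrimitive_of_forall_eq_jacobiSym`), so nothing else changes:

* `krizLi_characterBernoulliBlock_twist_odd_sqfree`.

Consumers: `…KrizLi4BlocksB19.lean`, `…KrizLi4BlocksB43.lean` (this seat). beyond-print theorem: NO.
References: [KrizLi2019] Thm. 1.20 (pp. 7–8), Rem. 1.21, §1.5, §2, §7.1; [Washington1997] §5.1, Thm. 4.2; [Cox2013] §1.C Lemma 1.14.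
-/

set_option autoImplicit false
set_option linter.dupNamespace false

noncomputable section

open scoped Classical

namespace Summit.BirchSwinnertonDyer.BirchSwinnertonDyer.Theorems.PrintCFram.KrizLiBindersTwisted

open scoped NumberTheorySymbols
open WeierstrassCurve IsDedekindDomain NumberField DirichletCharacter Literature.NumberTheory.LFunctions
  Literature.NumberTheory.EllipticCurves Literature.NumberTheory.EllipticCurves.ModularForms
  Literature.NumberTheory.EllipticCurves.Rank1Residual Literature.NumberTheory.EllipticCurves.KrizLi2019
  Summit.BirchSwinnertonDyer.Rank1Residual Summit.BirchSwinnertonDyer.Rank1Residual.X12.O11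
  Summit.BirchSwinnertonDyer.BirchSwinnertonDyer.Theorems.PrintCFram.OffLocus

variable {p : ℕ} [hp : Fact p.Prime]

set_option maxHeartbeats 800000 in
/-- **THE CHARACTER ∧ BERNOULLI BLOCK AT A TWISTED MEMBER, FROM TWO CERTIFICATES — `|d_K|` odd SQUAREFREE (not necessarily prime).**
w3 g3's `krizLi_characterBernoulliBlock_twist_odd` verbatim with the Heegner prime `q` replaced by an odd squarefree `q` coprime to `p·e`
(`ε_K(a) = J(a | q)` is still primitive of conductor `q`, w3 g2's `isPrimitive_of_forall_eq_jacobiSym`); needed for the census rows with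
`d_K ∈ {−15, −51, −143}`. ORIGINAL DOCSTRING: `p` odd; `E/ℚ` good away from `p` with trace
form `a_ℓ(E) ≡ ℓ^k + ℓ^{p−k}` (`2 ≤ k ≤ p−2`); `W ∼ W₁ ≅ E^{(e)}` with `e ≡ 1 (mod 4)` squarefree, `p ∤ e`; `χ` the `ℚ_p`-valued Jacobi
character mod `|e|` with `χ(−1)·(−1)^k = −1` (so `ψ = χ·ω^k` is odd); `ω` Teichmüller; `q ∤ 2pe` an odd prime and `εK` with values
`(·/q)`. From the UNIT certificates `‖B_{1,θ₁}‖ = 1` for `θ₁(j) = (j/|e|)·ω(j)^{p−1−k}` mod `p|e|` (class factor `ψ⁻¹`) and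
`‖B_{1,θ₂}‖ = 1` for `θ₂(j) = (j/|e|q)·ω(j)^{k−1}` mod `p|e|q` (`K''`-factor `ψε_Kω⁻¹`): `ψ` is PRIMITIVE, ODD, has `hss`, (1), (3)
for `W`, and Kriz–Li's (4) `¬ ‖B_{1,ψ₀⁻¹ε_K}·B_{1,ψ₀ω⁻¹}‖ ≤ p⁻¹` holds. (w3 g2's `AnchorBase.krizLi_characterBernoulliBlock_base` is the
case `e = 1`.) [cite: KrizLi2019, Thm. 1.20 (pp. 7–8), Rem. 1.21, §1.5, §2, §7.1] [cite: Washington1997, §5.1, Thm. 4.2] -/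
theorem krizLi_characterBernoulliBlock_twist_odd_sqfree (hp2 : p ≠ 2) (E : WeierstrassCurve ℚ) [E.IsElliptic] {k : ℕ}
    (hk2 : 2 ≤ k) (hkp : k ≤ p - 2)
    (hgood : ∀ (r : ℕ) [Fact r.Prime], r ≠ p → E.HasGoodReductionAtPrime r)
    (hbase : ∀ (ℓ : ℕ) [Fact ℓ.Prime], ℓ ≠ p → (E.LFunction ℓ : ZMod p) = (ℓ : ZMod p) ^ k + (ℓ : ZMod p) ^ (p - k))
    (W W₁ : WeierstrassCurve ℚ) [W.IsElliptic] [W₁.IsElliptic] (hiso : IsIsogenous W W₁)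
    {e : ℤ} (he4 : e % 4 = 1) (hsq : Squarefree e) (hpe : ¬ (p : ℤ) ∣ e)
    (hW₁ : ∃ C : VariableChange ℚ, C • W₁ = E.quadraticTwist (e : ℚ)) [NeZero e.natAbs]
    (χ : DirichletCharacter ℚ_[p] e.natAbs) (hχ : ∀ a : ℕ, χ (a : ZMod e.natAbs) = (J((a : ℤ) | e.natAbs) : ℚ_[p]))
    (hpar : χ (-1) * (-1) ^ k = -1)
    (ω : DirichletCharacter ℚ_[p] p) (hω : IsTeichmullerCharacter ω)
    {q : ℕ} [NeZero q] (hqodd : Odd q) (hqsq : Squarefree q) (hqp : q.Coprime p) (hqm : q.Coprime e.natAbs)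
    {d : ℕ} (hd : d = q) [NeZero d]
    (εK : DirichletCharacter ℚ_[p] d) (hεK : ∀ a : ℕ, εK (a : ZMod d) = (J((a : ℤ) | q) : ℚ_[p]))
    (hcert₁ : ∀ θ₁ : DirichletCharacter ℚ_[p] (p * e.natAbs),
      (∀ j : ZMod (p * e.natAbs), θ₁ j = (J((j.val : ℤ) | e.natAbs) : ℚ_[p]) * ω (j.val : ZMod p) ^ (p - 1 - k)) →
      ‖generalizedBernoulli 1 θ₁‖ = 1)
    (hcert₂ : ∀ θ₂ : DirichletCharacter ℚ_[p] (p * (e.natAbs * q)),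
      (∀ j : ZMod (p * (e.natAbs * q)), θ₂ j = (J((j.val : ℤ) | e.natAbs * q) : ℚ_[p]) * ω (j.val : ZMod p) ^ (k - 1)) →
      ‖generalizedBernoulli 1 θ₂‖ = 1) :
    ∃ (f : ℕ) (_ : NeZero f) (ψ : DirichletCharacter ℚ_[p] f),
      ψ.IsPrimitive ∧ ψ.Odd ∧
      (∀ ℓ : ℕ, ℓ.Prime → ¬ (ℓ ∣ p * W.conductorNorm ℤ) →
        ‖((W.LFunction ℓ : ℤ) : ℚ_[p]) - (ψ (ℓ : ZMod f) + ψ⁻¹ (ℓ : ZMod f) * ω (ℓ : ZMod p))‖ < 1) ∧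
      (ψ (p : ZMod f) ≠ 1 ∧ primVal (invMulOmega ψ ω) p ≠ 1) ∧
      (∀ ℓ : ℕ, (hℓ : ℓ.Prime) → ℓ ≠ p →
        (haveI := Fact.mk hℓ; ¬ W.HasGoodReductionAtPrime ℓ ∧ ¬ W.HasMultiplicativeReductionAtPrime ℓ) →
        ψ (ℓ : ZMod f) ≠ 1 ∧ primVal (invMulOmega ψ ω) ℓ ≠ 1) ∧
      ¬ (‖bernoulliOnePrim (bernoulliCharOne ψ εK) * bernoulliOnePrim (bernoulliCharTwo ψ εK ω)‖ ≤ (p : ℝ)⁻¹) := by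
  have hd' := hd.symm
  subst hd'
  have hpp : p.Prime := hp.out
  have hm0 : e.natAbs ≠ 0 := NeZero.ne e.natAbs
  have hmodd : Odd e.natAbs := by rw [Int.natAbs_odd, Int.odd_iff]; omega
  have hmsq : Squarefree e.natAbs := Int.squarefree_natAbs.mpr hsq
  have hpm : ¬ p ∣ e.natAbs := fun h => hpe (Int.natCast_dvd.mpr h)
  have hmp : (e.natAbs).Coprime p := ((Nat.Prime.coprime_iff_not_dvd hpp).mpr hpm).symm
  have hq0 : q ≠ 0 := hqsq.ne_zero
  have hmq : (e.natAbs).Coprime q := hqm.symm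
  haveI : NeZero (p * e.natAbs) := ⟨Nat.mul_ne_zero hpp.ne_zero hm0⟩
  haveI : NeZero (e.natAbs * q) := ⟨Nat.mul_ne_zero hm0 hq0⟩
  haveI : NeZero (p * (e.natAbs * q)) := ⟨Nat.mul_ne_zero hpp.ne_zero (NeZero.ne _)⟩
  -- the engine (w3 g2, part M)
  obtain ⟨hprim, hss, h1, h3⟩ := KrizLiBinders.krizLiBinders_of_coprime_twist_odd (p := p) hp2 E hk2 hkp hgood hbase
    W W₁ hiso he4 hsq hpe hW₁ χ hχ ω hω
  set ψ : DirichletCharacter ℚ_[p] (p * e.natAbs) :=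
    changeLevel (dvd_mul_left e.natAbs p) χ * changeLevel (dvd_mul_right p e.natAbs) (ω ^ k) with hψdef
  have hodd : ψ.Odd := by
    rw [hψdef]; exact KrizLiBinders.psi_odd_of ω χ k hp2 hω (by omega) hpar
  have hnev : ¬ ψ.Even := EisensteinPair.not_even_of_odd' ψ hodd
  refine ⟨p * e.natAbs, inferInstance, ψ, hprim, hodd, hss, h1, h3, ?_⟩
  -- χ is primitive quadratic
  have hχprim : χ.IsPrimitive := KrizLiBinders.isPrimitive_of_forall_eq_jacobiSym hχ hmodd hmsq
  have hχq : χ⁻¹ = χ := MulChar.IsQuadratic.inv (KrizLiBinders.isQuadratic_of_forall_eq_jacobiSym hχ)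
  -- θ₁ = ψ⁻¹ = χ↑·(ω^{p−1−k})↑
  set θ₁ : DirichletCharacter ℚ_[p] (p * e.natAbs) :=
    changeLevel (dvd_mul_left e.natAbs p) χ * changeLevel (dvd_mul_right p e.natAbs) (ω ^ (p - 1 - k)) with hθ₁def
  have hψinv : ψ⁻¹ = θ₁ := by
    rw [hψdef, hθ₁def, mul_inv, ← map_inv, ← map_inv, hχq, KrizLiBinders.char_pow_inv_eq ω (by omega)]
  have hθ₁prim : θ₁.IsPrimitive :=
    KrizLiBinders.psi_isPrimitive ω χ (p - 1 - k) hmp hχprim (KrizLiBinders.teichmuller_pow_ne_one hω (by omega) (by omega))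
  have hθ₁val : ∀ j : ZMod (p * e.natAbs), θ₁ j = (J((j.val : ℤ) | e.natAbs) : ℚ_[p]) * ω (j.val : ZMod p) ^ (p - 1 - k) := by
    intro j
    rw [hθ₁def, changeLevel_mul_apply_eq (p := p) χ (ω ^ (p - 1 - k)) j, hχ j.val, MulChar.pow_apply' _ (by omega)]
  have hu₁ : ‖generalizedBernoulli 1 θ₁‖ = 1 := hcert₁ θ₁ hθ₁val
  have h₁ : p * e.natAbs ∣ p * e.natAbs * q := dvd_mul_right _ q
  have hχ₁ : bernoulliCharOne ψ εK = changeLevel h₁ θ₁ := by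
    rw [RegularLocusBernoulliPair.bernoulliCharOne_of_not_even ψ εK hnev, hψinv]
  -- θ₂ = χ₂↑·(ω^{k−1})↑ with χ₂ the Jacobi character mod e.natAbs·q
  obtain ⟨χ₂, hχ₂⟩ := KrizLiBinders.exists_jacobiCharPadic (p := p) (e.natAbs * q)
  set θ₂ : DirichletCharacter ℚ_[p] (p * (e.natAbs * q)) :=
    changeLevel (dvd_mul_left (e.natAbs * q) p) χ₂ * changeLevel (dvd_mul_right p (e.natAbs * q)) (ω ^ (k - 1)) with hθ₂def
  have hθ₂prim : θ₂.IsPrimitive :=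
    KrizLiBinders.psi_isPrimitive ω χ₂ (k - 1) (Nat.Coprime.mul_left hmp hqp)
      (KrizLiBinders.isPrimitive_of_forall_eq_jacobiSym hχ₂ (hmodd.mul hqodd)
        (Nat.squarefree_mul_iff.mpr ⟨hmq, hmsq, hqsq⟩))
      (KrizLiBinders.teichmuller_pow_ne_one hω (by omega) (by omega))
  have hθ₂val : ∀ j : ZMod (p * (e.natAbs * q)), θ₂ j = (J((j.val : ℤ) | e.natAbs * q) : ℚ_[p]) * ω (j.val : ZMod p) ^ (k - 1) := by
    intro j
    rw [hθ₂def, changeLevel_mul_apply_eq (p := p) χ₂ (ω ^ (k - 1)) j, hχ₂ j.val, MulChar.pow_apply' _ (by omega)]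
  have hu₂ : ‖generalizedBernoulli 1 θ₂‖ = 1 := hcert₂ θ₂ hθ₂val
  -- identification of `ψ₀ω⁻¹` with the lift of `θ₂`
  have h₂ : p * (e.natAbs * q) ∣ p * e.natAbs * q * p := ⟨p, by ring⟩
  have hχ₂eq : bernoulliCharTwo ψ εK ω = changeLevel h₂ θ₂ := by
    haveI : NeZero (p * e.natAbs * q * p) := ⟨Nat.mul_ne_zero (Nat.mul_ne_zero (NeZero.ne _) hq0) hpp.ne_zero⟩
    rw [RegularLocusBernoulliPair.bernoulliCharTwo_of_not_even ψ εK ω hnev]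
    refine MulChar.ext fun u => ?_
    -- evaluate both sides at the integer `a = u.val`
    have hcop : ((u : ZMod (p * e.natAbs * q * p)).val).Coprime (p * e.natAbs * q * p) := ZMod.val_coe_unit_coprime u
    have ea : ((u : ZMod (p * e.natAbs * q * p)) : ZMod (p * e.natAbs * q * p)) =
        ((((u : ZMod (p * e.natAbs * q * p)).val : ℕ) : ℤ) : ZMod (p * e.natAbs * q * p)) := by
      rw [Int.cast_natCast, ZMod.natCast_zmod_val]
    set a : ℕ := (u : ZMod (p * e.natAbs * q * p)).val with ha
    have cL : IsCoprime (a : ℤ) ((p * e.natAbs * q * p : ℕ) : ℤ) := Nat.isCoprime_iff_coprime.mpr hcop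
    have cpmq : IsCoprime (a : ℤ) ((p * e.natAbs * q : ℕ) : ℤ) :=
      Nat.isCoprime_iff_coprime.mpr (hcop.coprime_dvd_right (Dvd.intro p rfl))
    have cpm : IsCoprime (a : ℤ) ((p * e.natAbs : ℕ) : ℤ) :=
      Nat.isCoprime_iff_coprime.mpr (hcop.coprime_dvd_right (Dvd.intro (q * p) (by ring)))
    have cpmq' : IsCoprime (a : ℤ) ((p * (e.natAbs * q) : ℕ) : ℤ) :=
      Nat.isCoprime_iff_coprime.mpr (hcop.coprime_dvd_right ⟨p, by ring⟩)
    have cap : a.Coprime p := hcop.coprime_dvd_right (Dvd.intro (e.natAbs * q * p) (by ring))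
    have hpa : ¬ ((p : ℤ) ∣ (a : ℤ)) := by
      rw [Int.natCast_dvd_natCast]; exact fun h => hpp.one_lt.ne' (Nat.Coprime.eq_one_of_dvd cap.symm h) |>.elim
    rw [ea, MulChar.mul_apply, changeLevel_eq_cast_of_dvd' _ _ cL, changeLevel_eq_cast_of_dvd' _ _ cL, MulChar.mul_apply,
      changeLevel_eq_cast_of_dvd' _ _ cpmq, changeLevel_eq_cast_of_dvd' _ _ cpmq, hψdef, MulChar.mul_apply,
      changeLevel_eq_cast_of_dvd' _ _ cpm, changeLevel_eq_cast_of_dvd' _ _ cpm,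
      changeLevel_eq_cast_of_dvd' _ _ cL, hθ₂def, MulChar.mul_apply,
      changeLevel_eq_cast_of_dvd' _ _ cpmq', changeLevel_eq_cast_of_dvd' _ _ cpmq']
    simp only [Int.cast_natCast]
    rw [hχ a, hεK a, hχ₂ a, MulChar.pow_apply' _ (by omega : k ≠ 0), MulChar.pow_apply' _ (by omega : k - 1 ≠ 0),
      MulChar.inv_apply_eq_inv', RouteU.jacobiSym_mul_right' (a : ℤ) hm0 hq0]
    have hω0 : ω (a : ZMod p) ≠ 0 := by
      have h1 := norm_apply_eq_one ω (a : ℤ) hpa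
      intro h0; rw [Int.cast_natCast] at h1; rw [h0, norm_zero] at h1; exact zero_ne_one h1
    have hk1 : k = (k - 1) + 1 := by omega
    push_cast
    rw [hk1, pow_succ, Nat.add_sub_cancel]
    field_simp
  exact RouteU.bernoulli_hypothesis_of_certs θ₁ hθ₁prim h₁ θ₂ hθ₂prim h₂ _ hχ₁ _ hχ₂eq hu₁ hu₂



end Summit.BirchSwinnertonDyer.BirchSwinnertonDyer.Theorems.PrintCFram.KrizLiBindersTwisted

end
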